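import Mathlib
import Literature.MathematicalPhysics.QuantumFieldTheory.Balaban1983to89.T4CubePoincare

/-!
# `Balaban1983to89.T4CubeShellBlocks` — SHELL CONDITIONING OF THE WINDOWED GIBBS LAW ON A CUBE, I: the cube covariance and its
# Brascamp–Lieb bound, concatenated configurations `ω_Δ ω_(Λ∖Δ) η`, and the Gibbsian kernel given a shell of coordinates
# (S. Friedli, Y. Velenik, *Statistical Mechanics of Lattice Systems*, CUP 2017 = [FriedliVelenik2017] §6.2.1 Lemma 6.7
# (6.7)–(6.10), Lemma 6.3, §6.10.1 (6.110), Exercise 3.11 (3.26); H. J. Brascamp, E. H. Lieb, JFA **22** (1976) =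
# [BrascampLieb1976] Thm 4.1; J. Glimm, A. Jaffe, *Quantum Physics* 2nd ed. 1987 = [GlimmJaffe1987] §4.3)

statement-and-proof file: textbook probability on the tree's cube model, every public declaration cite-tagged; nothing here is a
claim about the Yang–Mills mass gap

CITATION HEADER (lean-in-tree rule).  Ideation cell `ym-nodeO-ideate` (portfolio track), seat P8 «dual witness for the
β-interval bounds», memo `memos/ROUTE-p8.md` (v7.0 sha256 3f529b57…, referee REF g47 PASS 2026-08-27; v7.1 §72 records this
edition).  LANDING EDITION (generation 10), module I of 3 («CubeShell I–III») of the memo companion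
`memos/ROUTE-p8-SketchG7.lean` («G7», sha256 ee65fa81…, 1229 l., 65 declarations, 0 `sorry`, 0 `axiom`; REF g47 farm replication
rc 0, axioms standard): G7 §1 :73–:156 (`cubeCov`, `abs_cubeCov_le_amgm`, `abs_cubeCov_le`), G7 §6 :767–:791 ∕ :847–:860
(`setIntegral_centred_mul`, `cubeCov_eq_sub` with their docstrings, RELOCATED here so that module II does not import module III)
and G7 §2 :160–:255 (the `Shell` section).  Statements and proof terms are CHARACTER-IDENTICAL to G7's; edition deltas =
namespace (`YMNodeOIdeate.P8g7` → this module's), this header, the three-module split with imports, per-declaration cite tags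
replacing G7's bare folklore tags (each names the printed statement the declaration formalises or serves on the cube model;
proofs ours), one-line docstrings added to helpers G7 left bare, memo labels neutralised in docstrings (G6∕T-8.6 pointers); no
`private` in this module.  LABELS (memo-side words, NOT tree declarations): «(D1)»–«(D5)» = the five measure-side inputs of the
memo's level-0 «conditioning ∕ scale-doubling» scheme for covariance decay of windowed Gibbs laws (a quadratic scale recursion
`κ(2m) ≤ c·κ(m)² + η` fed by Brascamp–Lieb on the window, shell conditioning and the response identity) — the scheme, its seed
and its analytic inputs are NOT in the tree; labels `lab : Fin n → Fin 3`: `0` inside, `1` shell, `2` outside.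

HONEST FRAMING.  Nothing here is printed in Bałaban's papers and nothing is asserted about his densities: every declaration is
[folklore] probability ∕ calculus — the cube-window, continuous-spin instance of the cited textbook statements — on the TREE's
Euclidean cube model of a one-step fluctuation fibre `Balaban1983to89.T4CubePoincare` (`cube n S = [-S,S]ⁿ`, `cubeMass`,
`cubeMean`, `cubeVar`, the windowed Gibbs law `μ_K ∝ e^{-f} 1_K dx`, the convexity input `HessianBound f λ`).

WHAT IS PROVED (no `sorry`, no new axiom; `#print axioms` ⊆ {propext, Classical.choice, Quot.sound}).
* §1 «(D1)» `cubeCov f S F G` (the truncated two-point expectation `⟨FG⟩_K − …` in centred form, [GlimmJaffe1987] §4.3);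
  `abs_cubeCov_le_amgm`: `|Cov_K(F,G)| ≤ (t·Var_K F + t⁻¹·Var_K G)/2` (Cauchy–Schwarz, [Durrett2019] Thm 1.5.2, no convexity);
  **`abs_cubeCov_le`**: `f_xx ≥ λ` (`HessianBound f λ`), `|∇F|² ≤ a²`, `|∇G|² ≤ b²` on `K` ⇒ `|Cov_K(F,G)| ≤ λ⁻¹ab` — BY NAME from
  the tree's `T4CubePoincare.cubeVar_le_of_grad_le` = Brascamp–Lieb [BrascampLieb1976] Thm 4.1 on the window;
  `setIntegral_centred_mul`, `cubeCov_eq_sub` (centred = uncentred, `Cov_K(F,G) = ⟨FG⟩_K − ⟨F⟩_K⟨G⟩_K`).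
* §2 `merge lab x z` = the concatenated configuration of [FriedliVelenik2017] Lemma 6.7 (shell coordinates of `x`, the others of
  `z`) with its bookkeeping (`merge_apply_shell ∕ _of_ne`, `merge_eq_of_shell_eq`, `merge_add_smul_single`, `merge_mem_cube`,
  `continuous_merge_right ∕ _left`); the Gibbsian kernel given the shell with Lebesgue reference measure on the window,
  [FriedliVelenik2017] (6.110): `shellMass` (`Z(x_shell) = ∫_K e^(−f(merge x z)) dz`), `shellMean` (`E_μ[F | x_shell]`), `shellCov`;
  `shellMass_pos`; and SHELL-MEASURABILITY as Mathlib's `DependsOn · {i | lab i = 1}` ([FriedliVelenik2017] Lemma 6.3: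
  `𝓕_S`-measurable ⟺ a function of `ω_S`): `shellMass_dependsOn`, `shellMean_dependsOn`, `shellCov_dependsOn`.

NEAREST TREE ∕ MATHLIB ITEMS (dedup census; nothing restated).  `T4CubePoincare` is EXTENDED (its `cube ∕ cubeMass ∕ cubeMean ∕
cubeVar ∕ cubeVar_le_of_grad_le` used by name).  `Literature.Probability.LatticeModels.GibbsSpecification.glueWith Λ ζ η` (=
Mathlib `Function.updateFinset`, glue a `Λ`-configuration into a boundary condition, abstract sites ∕ spins) is the abstract
sibling of `merge` — here the carrier is `Fin n → ℝ` with a THREE-valued labelling (inside ∕ shell ∕ outside), which module II's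
Markov statement needs, and all integrals are the tree's `∫ x in cube n S … ∂volume`; `GibbsSpecification.gibbsSpecOfPotential`
∕ `GibbsSpecificationTilted` (kernels as `Measure.tilted` of glued product measures, events) are the abstract siblings of
`shellMean` (a ratio of parametric set integrals of continuous functions — the form modules II–III factorise and differentiate).
`Literature.Analysis.Quadrature.AnovaDecomposition.condMean` conditions PRODUCT probability measures (no Gibbs factor).
Mathlib: `DependsOn`, `Set.indicator`, `MeasureTheory.setIntegral_congr_fun`, `continuous_parametric_integral_of_continuous`.

CAVEATS ∕ NOT HERE.  (MODEL) the fibre is `ℝⁿ` with Lebesgue measure and a cube window, as in `T4CubePoincare`; Bałaban's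
fibre is a product of group copies read in a chart — that TRANSPORT is not here.  (RAW) no integrability hypotheses (compact cube,
continuous integrands); `S > 0` wherever a mass is inverted.  NOT HERE: any decay statement, any log-Sobolev ∕ cumulant BOUND,
any Combes–Thomas seed, the scale-recursion certificate, balls instead of cubes, anything about Bałaban's densities, [B12]
Theorem 2 or the cell's target `B13TermWalkDataOneTorus.ExistsUniformAcrossSmall`.  Value = kernel-checked measure-side identities
of the cube model, usable by name; NOT summit progress; no YM-PLAN ∕ Track-B node is claimed closed.  NEW file, imports built tree
modules only (and the earlier modules of this series); nothing modified; dimension-generic; net new unproved facts: 0.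
[cite: FriedliVelenik2017, Lemma 6.7 (6.7)–(6.10), Lemma 6.3, §6.10.1 (6.110); BrascampLieb1976, Thm 4.1; GlimmJaffe1987, §4.3] -/

set_option autoImplicit false

open MeasureTheory Set
open scoped Topology

namespace Literature.MathematicalPhysics.QuantumFieldTheory.Balaban1983to89.T4CubeShellBlocks

open Literature.MathematicalPhysics.QuantumFieldTheory.Balaban1983to89.T4CubePoincare
open Literature.Probability.Distributions

variable {n : ℕ}

/-! ## §1 «(D1)» the cube covariance, its Cauchy–Schwarz and Brascamp–Lieb bounds, centred = uncentred -/

section CubeCov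

/-- The cube covariance `Cov_K(F,G) = (∫_K (F − ⟨F⟩_K)(G − ⟨G⟩_K) e^{-f}) / Z_K` of the windowed Gibbs law
`μ_K ∝ e^{-f} 1_{[-S,S]ⁿ}` (companion of `T4CubePoincare.cubeMean` / `cubeVar`). [cite: GlimmJaffe1987, §4.3 (proof of Cor. 4.3.3)] -/
noncomputable def cubeCov (f : (Fin n → ℝ) → ℝ) (S : ℝ) (F G : (Fin n → ℝ) → ℝ) : ℝ :=
  (∫ x in cube n S, (F x - cubeMean f S F) * (G x - cubeMean f S G) * Real.exp (-f x)) / cubeMass f S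

/-- AM–GM form of Cauchy–Schwarz for the cube covariance: `|Cov_K(F,G)| ≤ (t·Var_K F + t⁻¹·Var_K G)/2` for every
`t > 0` (continuous `f, F, G`; no convexity needed here). [cite: Durrett2019, Thm 1.5.2] -/
theorem abs_cubeCov_le_amgm {S : ℝ} (hS : 0 < S) {f F G : (Fin n → ℝ) → ℝ} (hf : Continuous f)
    (hF : Continuous F) (hG : Continuous G) {t : ℝ} (ht : 0 < t) :
    |cubeCov f S F G| ≤ (t * cubeVar f S F + t⁻¹ * cubeVar f S G) / 2 := by
  have hZ : 0 < cubeMass f S := cubeMass_pos hf hS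
  set u : (Fin n → ℝ) → ℝ := fun x => F x - cubeMean f S F with hu
  set v : (Fin n → ℝ) → ℝ := fun x => G x - cubeMean f S G with hv
  set w : (Fin n → ℝ) → ℝ := fun x => Real.exp (-f x) with hw
  have huc : Continuous u := hF.sub continuous_const
  have hvc : Continuous v := hG.sub continuous_const
  have hwc : Continuous w := continuous_expNeg hf
  have hpt : ∀ x, |u x * v x * w x| ≤ (t * (u x ^ 2 * w x) + t⁻¹ * (v x ^ 2 * w x)) / 2 := by
    intro x
    have hwx : 0 < w x := Real.exp_pos _
    have h1 : |u x * v x * w x| = |u x| * |v x| * w x := by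
      rw [abs_mul, abs_mul, abs_of_pos hwx]
    have h2 : |u x| * |v x| ≤ (t * u x ^ 2 + t⁻¹ * v x ^ 2) / 2 := by
      have h3 : 2 * t * (|u x| * |v x|) ≤ t ^ 2 * u x ^ 2 + v x ^ 2 := by
        nlinarith [sq_nonneg (t * |u x| - |v x|), sq_abs (u x), sq_abs (v x)]
      have h4 : |u x| * |v x| = (2 * t * (|u x| * |v x|)) / (2 * t) := by
        field_simp
      rw [h4, div_le_iff₀ (by positivity)]
      calc 2 * t * (|u x| * |v x|) ≤ t ^ 2 * u x ^ 2 + v x ^ 2 := h3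
        _ = (t * u x ^ 2 + t⁻¹ * v x ^ 2) / 2 * (2 * t) := by field_simp
    rw [h1]
    calc |u x| * |v x| * w x ≤ (t * u x ^ 2 + t⁻¹ * v x ^ 2) / 2 * w x :=
          mul_le_mul_of_nonneg_right h2 hwx.le
      _ = (t * (u x ^ 2 * w x) + t⁻¹ * (v x ^ 2 * w x)) / 2 := by ring
  have hi_uvw : IntegrableOn (fun x => u x * v x * w x) (cube n S) volume :=
    integrableOn_cube' ((huc.mul hvc).mul hwc) S
  have hi_uu : IntegrableOn (fun x => u x ^ 2 * w x) (cube n S) volume :=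
    integrableOn_cube' ((huc.pow 2).mul hwc) S
  have hi_vv : IntegrableOn (fun x => v x ^ 2 * w x) (cube n S) volume :=
    integrableOn_cube' ((hvc.pow 2).mul hwc) S
  have hI : |∫ x in cube n S, u x * v x * w x| ≤
      (t * (∫ x in cube n S, u x ^ 2 * w x) + t⁻¹ * (∫ x in cube n S, v x ^ 2 * w x)) / 2 := by
    calc |∫ x in cube n S, u x * v x * w x| ≤ ∫ x in cube n S, |u x * v x * w x| := by
          simpa only [Real.norm_eq_abs] using
            norm_integral_le_integral_norm (μ := volume.restrict (cube n S)) (fun x => u x * v x * w x)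
      _ ≤ ∫ x in cube n S, (t * (u x ^ 2 * w x) + t⁻¹ * (v x ^ 2 * w x)) / 2 :=
          integral_mono hi_uvw.abs ((((hi_uu.const_mul t).add (hi_vv.const_mul t⁻¹))).div_const 2) hpt
      _ = (t * (∫ x in cube n S, u x ^ 2 * w x) + t⁻¹ * (∫ x in cube n S, v x ^ 2 * w x)) / 2 := by
          rw [integral_div, integral_add (hi_uu.const_mul t) (hi_vv.const_mul t⁻¹), integral_const_mul,
            integral_const_mul]
  have hcov : cubeCov f S F G = (∫ x in cube n S, u x * v x * w x) / cubeMass f S := rfl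
  have hVF : cubeVar f S F = (∫ x in cube n S, u x ^ 2 * w x) / cubeMass f S := rfl
  have hVG : cubeVar f S G = (∫ x in cube n S, v x ^ 2 * w x) / cubeMass f S := rfl
  rw [hcov, hVF, hVG, abs_div, abs_of_pos hZ]
  calc |∫ x in cube n S, u x * v x * w x| / cubeMass f S
        ≤ ((t * (∫ x in cube n S, u x ^ 2 * w x) + t⁻¹ * (∫ x in cube n S, v x ^ 2 * w x)) / 2) /
            cubeMass f S := div_le_div_of_nonneg_right hI hZ.le
    _ = (t * ((∫ x in cube n S, u x ^ 2 * w x) / cubeMass f S) +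
          t⁻¹ * ((∫ x in cube n S, v x ^ 2 * w x) / cubeMass f S)) / 2 := by
        field_simp

/-- **(D1) the covariance step on a window** (by name from the tree's
`T4CubePoincare.cubeVar_le_of_grad_le`): `f_xx ≥ λ`, `|∇F| ≤ a`, `|∇G| ≤ b` on the cube ⇒ `|Cov_K(F,G)| ≤ λ⁻¹ab`.
[cite: BrascampLieb1976, Thm 4.1] -/
theorem abs_cubeCov_le {S lam : ℝ} (hS : 0 < S) (hlam : 0 < lam) {f F G : (Fin n → ℝ) → ℝ}
    (hf : ContDiff ℝ 2 f) (hB : HessianBound f lam) (hF : ContDiff ℝ 1 F) (hG : ContDiff ℝ 1 G)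
    {a b : ℝ} (ha : 0 < a) (hb : 0 < b)
    (hFa : ∀ x ∈ cube n S, coordGradient F x ⬝ᵥ coordGradient F x ≤ a ^ 2)
    (hGb : ∀ x ∈ cube n S, coordGradient G x ⬝ᵥ coordGradient G x ≤ b ^ 2) :
    |cubeCov f S F G| ≤ lam⁻¹ * a * b := by
  have hVF : cubeVar f S F ≤ lam⁻¹ * a ^ 2 := cubeVar_le_of_grad_le hS hlam hf hB hF hFa
  have hVG : cubeVar f S G ≤ lam⁻¹ * b ^ 2 := cubeVar_le_of_grad_le hS hlam hf hB hG hGb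
  have ht : 0 < b / a := div_pos hb ha
  have h := abs_cubeCov_le_amgm hS hf.continuous hF.continuous hG.continuous ht
  calc |cubeCov f S F G| ≤ (b / a * cubeVar f S F + (b / a)⁻¹ * cubeVar f S G) / 2 := h
    _ ≤ (b / a * (lam⁻¹ * a ^ 2) + (b / a)⁻¹ * (lam⁻¹ * b ^ 2)) / 2 := by
        gcongr
    _ = lam⁻¹ * a * b := by
        field_simp
        ring

/-- Raw-moment expansion of a centred product on the cube:
`∫_K (F − a)(G − b) e^{-f} = I(FG) − a I(G) − b I(F) + ab Z`. [cite: GlimmJaffe1987, §4.3 (proof of Cor. 4.3.3)] -/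
theorem setIntegral_centred_mul {f F G : (Fin n → ℝ) → ℝ} (hf : Continuous f) (hF : Continuous F)
    (hG : Continuous G) (S a b : ℝ) :
    ∫ x in cube n S, (F x - a) * (G x - b) * Real.exp (-f x) =
      (∫ x in cube n S, F x * G x * Real.exp (-f x)) - a * (∫ x in cube n S, G x * Real.exp (-f x))
        - b * (∫ x in cube n S, F x * Real.exp (-f x)) + a * b * ∫ x in cube n S, Real.exp (-f x) := by
  have hE : Continuous fun x => Real.exp (-f x) := continuous_expNeg hf
  have i1 : IntegrableOn (fun x => F x * G x * Real.exp (-f x)) (cube n S) volume :=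
    integrableOn_cube' ((hF.mul hG).mul hE) S
  have i2 : IntegrableOn (fun x => a * (G x * Real.exp (-f x))) (cube n S) volume :=
    (integrableOn_cube' (hG.mul hE) S).const_mul a
  have i3 : IntegrableOn (fun x => b * (F x * Real.exp (-f x))) (cube n S) volume :=
    (integrableOn_cube' (hF.mul hE) S).const_mul b
  have i4 : IntegrableOn (fun x => a * b * Real.exp (-f x)) (cube n S) volume :=
    (integrableOn_cube' hE S).const_mul (a * b)
  have s1 : IntegrableOn (fun x => F x * G x * Real.exp (-f x) - a * (G x * Real.exp (-f x))) (cube n S) volume :=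
    i1.sub i2
  have s2 : IntegrableOn (fun x => F x * G x * Real.exp (-f x) - a * (G x * Real.exp (-f x))
      - b * (F x * Real.exp (-f x))) (cube n S) volume := s1.sub i3
  have hpt : (fun x => (F x - a) * (G x - b) * Real.exp (-f x)) = fun x =>
      F x * G x * Real.exp (-f x) - a * (G x * Real.exp (-f x)) - b * (F x * Real.exp (-f x))
        + a * b * Real.exp (-f x) := funext fun x => by ring
  rw [hpt, integral_add s2 i4, integral_sub s1 i3, integral_sub i1 i2,
    integral_const_mul, integral_const_mul, integral_const_mul]

/-- CENTRED = UNCENTRED cube covariance: `Cov_K(F,G) = ⟨FG⟩_K − ⟨F⟩_K⟨G⟩_K` (PROVED). [cite: GlimmJaffe1987, §4.3 (proof of Cor. 4.3.3)] -/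
theorem cubeCov_eq_sub {S : ℝ} (hS : 0 < S) {f F G : (Fin n → ℝ) → ℝ} (hf : Continuous f)
    (hF : Continuous F) (hG : Continuous G) :
    cubeCov f S F G = cubeMean f S (fun x => F x * G x) - cubeMean f S F * cubeMean f S G := by
  have hZ : cubeMass f S ≠ 0 := (cubeMass_pos hf hS).ne'
  simp only [cubeCov, cubeMean]
  rw [setIntegral_centred_mul hf hF hG]
  rw [show (∫ x in cube n S, Real.exp (-f x)) = cubeMass f S from rfl]
  generalize (∫ x in cube n S, F x * G x * Real.exp (-f x)) = mFG
  generalize (∫ x in cube n S, F x * Real.exp (-f x)) = mF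
  generalize (∫ x in cube n S, G x * Real.exp (-f x)) = mG
  generalize hZ' : cubeMass f S = Z at hZ ⊢
  field_simp
  ring

end CubeCov

/-! ## §2 Concatenated configurations (inside `0` ∕ shell `1` ∕ outside `2`) and the Gibbsian kernel given the shell -/

section Shell

/-- `merge lab x z`: the point with the SHELL coordinates (`lab i = 1`) of `x` and all other coordinates of `z`.
[cite: FriedliVelenik2017, Lemma 6.7 (6.7)–(6.10)] -/
def merge (lab : Fin n → Fin 3) (x z : Fin n → ℝ) : Fin n → ℝ :=
  fun i => if lab i = 1 then x i else z i

/-- On a shell coordinate (`lab i = 1`) `merge lab x z` reads `x`. [cite: FriedliVelenik2017, Lemma 6.7 (6.7)–(6.10)] -/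
theorem merge_apply_shell {lab : Fin n → Fin 3} {i : Fin n} (hi : lab i = 1) (x z : Fin n → ℝ) :
    merge lab x z i = x i := by simp [merge, hi]

/-- Off the shell (`lab i ≠ 1`) `merge lab x z` reads `z`. [cite: FriedliVelenik2017, Lemma 6.7 (6.7)–(6.10)] -/
theorem merge_apply_of_ne {lab : Fin n → Fin 3} {i : Fin n} (hi : lab i ≠ 1) (x z : Fin n → ℝ) :
    merge lab x z i = z i := by simp [merge, hi]

/-- `merge` only reads the shell coordinates of its first argument. [cite: FriedliVelenik2017, Lemma 6.7 (6.7)–(6.10)] -/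
theorem merge_eq_of_shell_eq {lab : Fin n → Fin 3} {x y : Fin n → ℝ} (h : ∀ i, lab i = 1 → x i = y i)
    (z : Fin n → ℝ) : merge lab x z = merge lab y z := by
  funext i
  by_cases hi : lab i = 1
  · rw [merge_apply_shell hi, merge_apply_shell hi, h i hi]
  · rw [merge_apply_of_ne hi, merge_apply_of_ne hi]

/-- Moving a SHELL coordinate of `x` moves the merged point along the same axis. [cite: FriedliVelenik2017, Lemma 6.7 (6.7)–(6.10)] -/
theorem merge_add_smul_single {lab : Fin n → Fin 3} {j : Fin n} (hj : lab j = 1) (x z : Fin n → ℝ) (t : ℝ) :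
    merge lab (x + t • Pi.single j 1) z = merge lab x z + t • Pi.single j 1 := by
  funext i
  by_cases hi : lab i = 1
  · simp [merge, hi]
  · have hij : i ≠ j := fun h => hi (h ▸ hj)
    simp [merge, hi, hij]

/-- The cube is stable under `merge`. [cite: FriedliVelenik2017, Lemma 6.7 (6.7)–(6.10)] -/
theorem merge_mem_cube {lab : Fin n → Fin 3} {S : ℝ} {x z : Fin n → ℝ} (hx : x ∈ cube n S) (hz : z ∈ cube n S) :
    merge lab x z ∈ cube n S := by
  rw [mem_cube_iff] at hx hz ⊢
  intro i
  by_cases hi : lab i = 1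
  · rw [merge_apply_shell hi]; exact hx i
  · rw [merge_apply_of_ne hi]; exact hz i

/-- `z ↦ merge lab x z` is continuous. [cite: FriedliVelenik2017, Lemma 6.7 (6.7)–(6.10)] -/
theorem continuous_merge_right (lab : Fin n → Fin 3) (x : Fin n → ℝ) : Continuous (merge lab x) := by
  refine continuous_pi fun i => ?_
  by_cases hi : lab i = 1
  · simp only [merge, hi, if_true]; exact continuous_const
  · simp only [merge, hi, if_false]; exact continuous_apply i

/-- `x ↦ merge lab x z` is continuous. [cite: FriedliVelenik2017, Lemma 6.7 (6.7)–(6.10)] -/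
theorem continuous_merge_left (lab : Fin n → Fin 3) (z : Fin n → ℝ) : Continuous fun x => merge lab x z := by
  refine continuous_pi fun i => ?_
  by_cases hi : lab i = 1
  · simp only [merge, hi, if_true]; exact continuous_apply i
  · simp only [merge, hi, if_false]; exact continuous_const

/-- THE SHELL-CONDITIONAL MASS `Z(x_shell) = ∫_K e^{-f(x_shell, z_rest)} dz` (the `z_shell`-integration contributes the
harmless factor `(2S)^{#shell}`). [cite: FriedliVelenik2017, §6.10.1 (6.110)] -/
noncomputable def shellMass (lab : Fin n → Fin 3) (f : (Fin n → ℝ) → ℝ) (S : ℝ) (x : Fin n → ℝ) : ℝ :=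
  ∫ z in cube n S, Real.exp (-f (merge lab x z))

/-- THE SHELL-CONDITIONAL MEAN `E_{μ_K}[F | x_shell] = (∫_K F(x_shell,z) e^{-f(x_shell,z)} dz) / Z(x_shell)` of the
windowed Gibbs law `μ_K ∝ e^{-f} 1_K` — a function of `x` through its shell coordinates only
(`shellMean_dependsOn`). [cite: FriedliVelenik2017, §6.10.1 (6.110)] -/
noncomputable def shellMean (lab : Fin n → Fin 3) (f : (Fin n → ℝ) → ℝ) (S : ℝ) (F : (Fin n → ℝ) → ℝ)
    (x : Fin n → ℝ) : ℝ :=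
  (∫ z in cube n S, F (merge lab x z) * Real.exp (-f (merge lab x z))) / shellMass lab f S x

/-- THE SHELL-CONDITIONAL COVARIANCE `Cov_{μ_K}(F, G | x_shell) = E[FG|·] − E[F|·]E[G|·]`. [cite: FriedliVelenik2017, §6.10.1 (6.110)] -/
noncomputable def shellCov (lab : Fin n → Fin 3) (f : (Fin n → ℝ) → ℝ) (S : ℝ) (F G : (Fin n → ℝ) → ℝ)
    (x : Fin n → ℝ) : ℝ :=
  shellMean lab f S (fun y => F y * G y) x - shellMean lab f S F x * shellMean lab f S G x

/-- The conditional mass is positive (`S > 0`, `f` continuous). [cite: FriedliVelenik2017, §6.10.1 (6.110)] -/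
theorem shellMass_pos (lab : Fin n → Fin 3) {f : (Fin n → ℝ) → ℝ} (hf : Continuous f) {S : ℝ} (hS : 0 < S)
    (x : Fin n → ℝ) : 0 < shellMass lab f S x :=
  setIntegral_exp_neg_pos (hf.comp (continuous_merge_right lab x)) hS

/-- The conditional mass depends on the shell coordinates only. [cite: FriedliVelenik2017, Lemma 6.3; FriedliVelenik2017, Exercise 3.11 (3.26)] -/
theorem shellMass_dependsOn (lab : Fin n → Fin 3) (f : (Fin n → ℝ) → ℝ) (S : ℝ) :
    DependsOn (shellMass lab f S) {i | lab i = 1} := by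
  intro x y hxy
  have h : ∀ z, merge lab x z = merge lab y z := merge_eq_of_shell_eq fun i hi => hxy i hi
  simp only [shellMass, h]

/-- The conditional mean is SHELL-MEASURABLE: it depends on the shell coordinates only. [cite: FriedliVelenik2017, Lemma 6.3; FriedliVelenik2017, Exercise 3.11 (3.26)] -/
theorem shellMean_dependsOn (lab : Fin n → Fin 3) (f : (Fin n → ℝ) → ℝ) (S : ℝ) (F : (Fin n → ℝ) → ℝ) :
    DependsOn (shellMean lab f S F) {i | lab i = 1} := by
  intro x y hxy
  have h : ∀ z, merge lab x z = merge lab y z := merge_eq_of_shell_eq fun i hi => hxy i hi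
  simp only [shellMean, shellMass, h]

/-- … and so does the conditional covariance. [cite: FriedliVelenik2017, Lemma 6.3; FriedliVelenik2017, Exercise 3.11 (3.26)] -/
theorem shellCov_dependsOn (lab : Fin n → Fin 3) (f : (Fin n → ℝ) → ℝ) (S : ℝ) (F G : (Fin n → ℝ) → ℝ) :
    DependsOn (shellCov lab f S F G) {i | lab i = 1} := by
  intro x y hxy
  simp only [shellCov, shellMean_dependsOn lab f S _ hxy]

end Shell

end Literature.MathematicalPhysics.QuantumFieldTheory.Balaban1983to89.T4CubeShellBlocks
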